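import Summits.BirchSwinnertonDyer.BirchSwinnertonDyer.Theorems.KatoDescentPotSupersingularWildUpperUnitTwistRecordsFlat65
import Summits.BirchSwinnertonDyer.BirchSwinnertonDyer.Theorems.KatoDescentPotSupersingularWildUpperUnitTwistRecordsFlat66
import Summits.BirchSwinnertonDyer.BirchSwinnertonDyer.Theorems.KatoDescentPotSupersingularWildUpperUnitTwistRecordsFlat67
import Summits.BirchSwinnertonDyer.BirchSwinnertonDyer.Theorems.KatoDescentPotSupersingularWildUpperUnitTwistRecordsFlat68
import HarnessLib

/-!
# Route `KatoDescentPotSupersingular` (rung K9, sub-rung B5 = O6 wild `p = 3`, cell `bsd-potss`): `BSD₃` OF THE PAIR `(E, 3)` for the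
# U₀-ns ♭ rows whose own `#Ш_an(E)` is a `3`-adic unit — corollaries of the landed unit-twist KERNEL RECORDS (part 17: 382347g1@3, 388800hv1@3, 392418d1@3, 412992bw1@3, 443205j1@3, 447174cg1@3, 457056bd1@3, 496800cq1@3, 499392kg1@3)
# (seat `bsd-potss-k9-c4` g17; `--supports stmt-BirchSwinnertonDyer-19197 --as helper`)

HONEST FRAMING. THEOREMS ONLY; PER PAIR — NOT a class theorem; nothing is booked by this file (booking is the referees' word on the
b2b residue lane); items 19189 / 19197 stay OPEN at class level; BSD is not proved for any CLASS by this.  For each listed row the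
landed record `WildUpperUnitTwistRecords.missingUpperBoundAt_g<label>_3` (files `…WildUpperUnitTwistRecordsFlatNN`, k9-c4 g16/g17) gives
the UPPER half `ord₃ #Ш(E) ≤ ord₃ #Ш(E)_an` from PUBLISHED inputs (Matar–Nekovář 2019 Thm 0.3, Gross–Zagier, Kolyvagin, GZK,
modularity — displayed `hGZ hKo hMN hGZK hmod`) + the displayed datum/numerics; when moreover `#Ш(E)_an` is a `3`-adic UNIT
(displayed: `hsha : shaAn W = q₀`, `hv₀ : ord₃ q₀ ≤ 0` — Cremona's `#Ш_an = 1` on every row here, b2b O6 class list `ord_p_sha = 0`)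
the LOWER half is trivial and `Typed.missingPPartAt_of_lower_of_upper` + `Typed.bsdp_of_missingPPartAt` (GZK for `rank = r_an`, `Ш`
finite) give Miller's `BSD(E,3)` = `BSDp W 3`.  Exactly kmc g21's F15 §2 shape
(`AdditiveUnitTwistCertificate.bsdp_rankZero_irreducible_of_unitShaAn_at_unitTwistDatum_of_matarNekovar`, p574309) in record-input
form.  CONDITIONAL on every displayed hypothesis; the numerics (`r_an`, `#Ш_an` of `E` and of the twist) are EVIDENCE (Cremona's
tables / kits j297595, j297596, j297999, j298525 of k9-c4 g16 and j301922 of this seat), not kernel facts.  These are the «F15-bookable pairs» of kmc g21's FINDING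
(HOME/bsd-potss-kmc/g21) on the K9 side, now as kernel theorems; whether and at what tier a pair is booked is the residue lane's /
referees' decision, not this file's.

References: [MatarNekovar2019] Thm. 0.3, §0.11; [GrossZagier1986] I.6.3, V.§2; [KolyvaginEulerSystems1990] Thm. A; [Miller2011LMS]
§1, Def. 1.1; [Darmon2004] Thm. 3.22; [Cremona2006] Table 1 and Table 4.
-/

set_option autoImplicit false
set_option linter.dupNamespace false
noncomputable section
open scoped Classical NumberField
open WeierstrassCurve NumberField Field
  Literature.NumberTheory.EllipticCurves
  Literature.NumberTheory.EllipticCurves.ModularForms Literature.NumberTheory.EllipticCurves.Rank1Residual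
  Literature.NumberTheory.EllipticCurves.Rank1Residual.Typed Literature.NumberTheory.Automorphic
  Summit.BirchSwinnertonDyer.Rank1Residual Summit.BirchSwinnertonDyer.Rank1Residual.Additive
  Summit.BirchSwinnertonDyer.BirchSwinnertonDyer.Theorems

namespace Summit.BirchSwinnertonDyer.BirchSwinnertonDyer.Theorems.WildUpperUnitTwistRecords

/-- **`BSD(E,3)` (Miller) for the PAIR `E = 382347g1`, `p = 3`** — O6 wild `3`, U₀-ns ♭ row, `E[3]` irreducible, `r_an = 0`,
Cremona `#Ш(E)_an = 1` (a `3`-adic unit, DISPLAYED as `hsha`/`hv₀`): from the landed record `missingUpperBoundAt_g382347g1_3`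
(upper half ⟸ MN19 0.3 + GZ + Kolyvagin + GZK + modularity + the unit rank-one twist `d_K = -2327`, all displayed) the lower half is
trivial and GZK closes Miller's `BSD(E,3)`.  CONDITIONAL on the displayed hypotheses; per pair; books nothing by itself.
[cite: Miller2011LMS, §1 and Def. 1.1] [cite: MatarNekovar2019, Thm. 0.3 (p. 456)] [cite: Cremona2006, Table 4 (Cremona label 382347g1)] -/
theorem bsdp_g382347g1_3
    (hGZ : ∀ (N : ℕ) [NeZero N] (W : WeierstrassCurve ℚ) (K : Type) [Field K] [NumberField K],
      gross_zagier N W K)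
    (hKo : ∀ (N : ℕ) [NeZero N] (W : WeierstrassCurve ℚ) (K : Type) [Field K] [NumberField K],
      kolyvagin N W K)
    (hMN : ∀ (N : ℕ) [NeZero N] (W : WeierstrassCurve ℚ) (K : Type) [Field K] [NumberField K],
      MatarNekovar2019.thm03_padicValNat_card_sha_le_of_irreducible N W K)
    (hGZK : rank_eq_analyticRank_of_analyticRank_le_one) (hmod : hasEntireLFunction_rat)
    {W : WeierstrassCurve ℚ} [W.IsElliptic] [W.IsGloballyMinimal] (hWeq : W = (⟨0, 0, 1, (-13382145), 11704693124⟩ : WeierstrassCurve ℚ))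
    (hN : W.conductorNorm ℤ = 382347) (hr : W.analyticRank = 0) (htam : ¬ 3 ∣ W.tamagawaProduct)
    (D : ModularParametrizationData W 382347) (hc : ¬ (3 : ℤ) ∣ D.c)
    (K : Type) [Field K] [NumberField K] (hK : IsImaginaryQuadratic K) (hdK : NumberField.discr K = -2327)
    {Wd : WeierstrassCurve ℚ} [Wd.IsElliptic] [Wd.IsGloballyMinimal] (hWdeq : Wd = (⟨0, 0, 1, (-72463365042705), (-147485451359918687038)⟩ : WeierstrassCurve ℚ))
    (hrd : Wd.analyticRank = 1) {qd : ℚ} (hqd : shaAn Wd = (qd : ℂ)) (hvd : padicValRat 3 qd ≤ 0)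
    {q₀ : ℚ} (hsha : shaAn W = (q₀ : ℂ)) (hv₀ : padicValRat 3 q₀ ≤ 0) :
    BSDp W 3 :=
  bsdp_of_missingPPartAt W 3 hGZK (by rw [hr]; exact zero_le_one)
    (missingPPartAt_of_lower_of_upper W 3 ⟨q₀, hsha, le_trans hv₀ (by exact_mod_cast Nat.zero_le _)⟩
      (missingUpperBoundAt_g382347g1_3 hGZ hKo hMN hGZK hmod hWeq hN hr htam D hc K hK hdK hWdeq hrd hqd hvd))

/-- **`BSD(E,3)` (Miller) for the PAIR `E = 388800hv1`, `p = 3`** — O6 wild `3`, U₀-ns ♭ row, `E[3]` irreducible, `r_an = 0`,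
Cremona `#Ш(E)_an = 1` (a `3`-adic unit, DISPLAYED as `hsha`/`hv₀`): from the landed record `missingUpperBoundAt_g388800hv1_3`
(upper half ⟸ MN19 0.3 + GZ + Kolyvagin + GZK + modularity + the unit rank-one twist `d_K = -1079`, all displayed) the lower half is
trivial and GZK closes Miller's `BSD(E,3)`.  CONDITIONAL on the displayed hypotheses; per pair; books nothing by itself.
[cite: Miller2011LMS, §1 and Def. 1.1] [cite: MatarNekovar2019, Thm. 0.3 (p. 456)] [cite: Cremona2006, Table 4 (Cremona label 388800hv1)] -/
theorem bsdp_g388800hv1_3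
    (hGZ : ∀ (N : ℕ) [NeZero N] (W : WeierstrassCurve ℚ) (K : Type) [Field K] [NumberField K],
      gross_zagier N W K)
    (hKo : ∀ (N : ℕ) [NeZero N] (W : WeierstrassCurve ℚ) (K : Type) [Field K] [NumberField K],
      kolyvagin N W K)
    (hMN : ∀ (N : ℕ) [NeZero N] (W : WeierstrassCurve ℚ) (K : Type) [Field K] [NumberField K],
      MatarNekovar2019.thm03_padicValNat_card_sha_le_of_irreducible N W K)
    (hGZK : rank_eq_analyticRank_of_analyticRank_le_one) (hmod : hasEntireLFunction_rat)
    {W : WeierstrassCurve ℚ} [W.IsElliptic] [W.IsGloballyMinimal] (hWeq : W = (⟨0, 0, 0, (-4860), 130410⟩ : WeierstrassCurve ℚ))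
    (hN : W.conductorNorm ℤ = 388800) (hr : W.analyticRank = 0) (htam : ¬ 3 ∣ W.tamagawaProduct)
    (D : ModularParametrizationData W 388800) (hc : ¬ (3 : ℤ) ∣ D.c)
    (K : Type) [Field K] [NumberField K] (hK : IsImaginaryQuadratic K) (hdK : NumberField.discr K = -1079)
    {Wd : WeierstrassCurve ℚ} [Wd.IsElliptic] [Wd.IsGloballyMinimal] (hWdeq : Wd = (⟨0, 0, 0, (-5658211260), (-163823133645990)⟩ : WeierstrassCurve ℚ))
    (hrd : Wd.analyticRank = 1) {qd : ℚ} (hqd : shaAn Wd = (qd : ℂ)) (hvd : padicValRat 3 qd ≤ 0)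
    {q₀ : ℚ} (hsha : shaAn W = (q₀ : ℂ)) (hv₀ : padicValRat 3 q₀ ≤ 0) :
    BSDp W 3 :=
  bsdp_of_missingPPartAt W 3 hGZK (by rw [hr]; exact zero_le_one)
    (missingPPartAt_of_lower_of_upper W 3 ⟨q₀, hsha, le_trans hv₀ (by exact_mod_cast Nat.zero_le _)⟩
      (missingUpperBoundAt_g388800hv1_3 hGZ hKo hMN hGZK hmod hWeq hN hr htam D hc K hK hdK hWdeq hrd hqd hvd))

/-- **`BSD(E,3)` (Miller) for the PAIR `E = 392418d1`, `p = 3`** — O6 wild `3`, U₀-ns ♭ row, `E[3]` irreducible, `r_an = 0`,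
Cremona `#Ш(E)_an = 4` (a `3`-adic unit, DISPLAYED as `hsha`/`hv₀`): from the landed record `missingUpperBoundAt_g392418d1_3`
(upper half ⟸ MN19 0.3 + GZ + Kolyvagin + GZK + modularity + the unit rank-one twist `d_K = -2759`, all displayed) the lower half is
trivial and GZK closes Miller's `BSD(E,3)`.  CONDITIONAL on the displayed hypotheses; per pair; books nothing by itself.
[cite: Miller2011LMS, §1 and Def. 1.1] [cite: MatarNekovar2019, Thm. 0.3 (p. 456)] [cite: Cremona2006, Table 4 (Cremona label 392418d1)] -/
theorem bsdp_g392418d1_3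
    (hGZ : ∀ (N : ℕ) [NeZero N] (W : WeierstrassCurve ℚ) (K : Type) [Field K] [NumberField K],
      gross_zagier N W K)
    (hKo : ∀ (N : ℕ) [NeZero N] (W : WeierstrassCurve ℚ) (K : Type) [Field K] [NumberField K],
      kolyvagin N W K)
    (hMN : ∀ (N : ℕ) [NeZero N] (W : WeierstrassCurve ℚ) (K : Type) [Field K] [NumberField K],
      MatarNekovar2019.thm03_padicValNat_card_sha_le_of_irreducible N W K)
    (hGZK : rank_eq_analyticRank_of_analyticRank_le_one) (hmod : hasEntireLFunction_rat)
    {W : WeierstrassCurve ℚ} [W.IsElliptic] [W.IsGloballyMinimal] (hWeq : W = (⟨1, (-1), 0, (-26771406), 53319482828⟩ : WeierstrassCurve ℚ))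
    (hN : W.conductorNorm ℤ = 392418) (hr : W.analyticRank = 0) (htam : ¬ 3 ∣ W.tamagawaProduct)
    (D : ModularParametrizationData W 392418) (hc : ¬ (3 : ℤ) ∣ D.c)
    (K : Type) [Field K] [NumberField K] (hK : IsImaginaryQuadratic K) (hdK : NumberField.discr K = -2759)
    {Wd : WeierstrassCurve ℚ} [Wd.IsElliptic] [Wd.IsGloballyMinimal] (hWdeq : Wd = (⟨1, (-1), 0, (-203786112383151), (-1119660848535591320347)⟩ : WeierstrassCurve ℚ))
    (hrd : Wd.analyticRank = 1) {qd : ℚ} (hqd : shaAn Wd = (qd : ℂ)) (hvd : padicValRat 3 qd ≤ 0)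
    {q₀ : ℚ} (hsha : shaAn W = (q₀ : ℂ)) (hv₀ : padicValRat 3 q₀ ≤ 0) :
    BSDp W 3 :=
  bsdp_of_missingPPartAt W 3 hGZK (by rw [hr]; exact zero_le_one)
    (missingPPartAt_of_lower_of_upper W 3 ⟨q₀, hsha, le_trans hv₀ (by exact_mod_cast Nat.zero_le _)⟩
      (missingUpperBoundAt_g392418d1_3 hGZ hKo hMN hGZK hmod hWeq hN hr htam D hc K hK hdK hWdeq hrd hqd hvd))

/-- **`BSD(E,3)` (Miller) for the PAIR `E = 412992bw1`, `p = 3`** — O6 wild `3`, U₀-ns ♭ row, `E[3]` irreducible, `r_an = 0`,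
Cremona `#Ш(E)_an = 64` (a `3`-adic unit, DISPLAYED as `hsha`/`hv₀`): from the landed record `missingUpperBoundAt_g412992bw1_3`
(upper half ⟸ MN19 0.3 + GZ + Kolyvagin + GZK + modularity + the unit rank-one twist `d_K = -2807`, all displayed) the lower half is
trivial and GZK closes Miller's `BSD(E,3)`.  CONDITIONAL on the displayed hypotheses; per pair; books nothing by itself.
[cite: Miller2011LMS, §1 and Def. 1.1] [cite: MatarNekovar2019, Thm. 0.3 (p. 456)] [cite: Cremona2006, Table 4 (Cremona label 412992bw1)] -/
theorem bsdp_g412992bw1_3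
    (hGZ : ∀ (N : ℕ) [NeZero N] (W : WeierstrassCurve ℚ) (K : Type) [Field K] [NumberField K],
      gross_zagier N W K)
    (hKo : ∀ (N : ℕ) [NeZero N] (W : WeierstrassCurve ℚ) (K : Type) [Field K] [NumberField K],
      kolyvagin N W K)
    (hMN : ∀ (N : ℕ) [NeZero N] (W : WeierstrassCurve ℚ) (K : Type) [Field K] [NumberField K],
      MatarNekovar2019.thm03_padicValNat_card_sha_le_of_irreducible N W K)
    (hGZK : rank_eq_analyticRank_of_analyticRank_le_one) (hmod : hasEntireLFunction_rat)
    {W : WeierstrassCurve ℚ} [W.IsElliptic] [W.IsGloballyMinimal] (hWeq : W = (⟨0, 0, 0, (-43798121268), (-3528022418672640)⟩ : WeierstrassCurve ℚ))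
    (hN : W.conductorNorm ℤ = 412992) (hr : W.analyticRank = 0) (htam : ¬ 3 ∣ W.tamagawaProduct)
    (D : ModularParametrizationData W 412992) (hc : ¬ (3 : ℤ) ∣ D.c)
    (K : Type) [Field K] [NumberField K] (hK : IsImaginaryQuadratic K) (hdK : NumberField.discr K = -2807)
    {Wd : WeierstrassCurve ℚ} [Wd.IsElliptic] [Wd.IsGloballyMinimal] (hWdeq : Wd = (⟨0, 0, 0, (-345096303202767732), 78029455089851271992939520⟩ : WeierstrassCurve ℚ))
    (hrd : Wd.analyticRank = 1) {qd : ℚ} (hqd : shaAn Wd = (qd : ℂ)) (hvd : padicValRat 3 qd ≤ 0)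
    {q₀ : ℚ} (hsha : shaAn W = (q₀ : ℂ)) (hv₀ : padicValRat 3 q₀ ≤ 0) :
    BSDp W 3 :=
  bsdp_of_missingPPartAt W 3 hGZK (by rw [hr]; exact zero_le_one)
    (missingPPartAt_of_lower_of_upper W 3 ⟨q₀, hsha, le_trans hv₀ (by exact_mod_cast Nat.zero_le _)⟩
      (missingUpperBoundAt_g412992bw1_3 hGZ hKo hMN hGZK hmod hWeq hN hr htam D hc K hK hdK hWdeq hrd hqd hvd))

/-- **`BSD(E,3)` (Miller) for the PAIR `E = 443205j1`, `p = 3`** — O6 wild `3`, U₀-ns ♭ row, `E[3]` irreducible, `r_an = 0`,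
Cremona `#Ш(E)_an = 1` (a `3`-adic unit, DISPLAYED as `hsha`/`hv₀`): from the landed record `missingUpperBoundAt_g443205j1_3`
(upper half ⟸ MN19 0.3 + GZ + Kolyvagin + GZK + modularity + the unit rank-one twist `d_K = -6131`, all displayed) the lower half is
trivial and GZK closes Miller's `BSD(E,3)`.  CONDITIONAL on the displayed hypotheses; per pair; books nothing by itself.
[cite: Miller2011LMS, §1 and Def. 1.1] [cite: MatarNekovar2019, Thm. 0.3 (p. 456)] [cite: Cremona2006, Table 4 (Cremona label 443205j1)] -/
theorem bsdp_g443205j1_3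
    (hGZ : ∀ (N : ℕ) [NeZero N] (W : WeierstrassCurve ℚ) (K : Type) [Field K] [NumberField K],
      gross_zagier N W K)
    (hKo : ∀ (N : ℕ) [NeZero N] (W : WeierstrassCurve ℚ) (K : Type) [Field K] [NumberField K],
      kolyvagin N W K)
    (hMN : ∀ (N : ℕ) [NeZero N] (W : WeierstrassCurve ℚ) (K : Type) [Field K] [NumberField K],
      MatarNekovar2019.thm03_padicValNat_card_sha_le_of_irreducible N W K)
    (hGZK : rank_eq_analyticRank_of_analyticRank_le_one) (hmod : hasEntireLFunction_rat)
    {W : WeierstrassCurve ℚ} [W.IsElliptic] [W.IsGloballyMinimal] (hWeq : W = (⟨1, (-1), 1, (-177953), 30535012⟩ : WeierstrassCurve ℚ))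
    (hN : W.conductorNorm ℤ = 443205) (hr : W.analyticRank = 0) (htam : ¬ 3 ∣ W.tamagawaProduct)
    (D : ModularParametrizationData W 443205) (hc : ¬ (3 : ℤ) ∣ D.c)
    (K : Type) [Field K] [NumberField K] (hK : IsImaginaryQuadratic K) (hdK : NumberField.discr K = -6131)
    {Wd : WeierstrassCurve ℚ} [Wd.IsElliptic] [Wd.IsGloballyMinimal] (hWdeq : Wd = (⟨1, (-1), 0, (-6689092220820), (-7026818474239631425)⟩ : WeierstrassCurve ℚ))
    (hrd : Wd.analyticRank = 1) {qd : ℚ} (hqd : shaAn Wd = (qd : ℂ)) (hvd : padicValRat 3 qd ≤ 0)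
    {q₀ : ℚ} (hsha : shaAn W = (q₀ : ℂ)) (hv₀ : padicValRat 3 q₀ ≤ 0) :
    BSDp W 3 :=
  bsdp_of_missingPPartAt W 3 hGZK (by rw [hr]; exact zero_le_one)
    (missingPPartAt_of_lower_of_upper W 3 ⟨q₀, hsha, le_trans hv₀ (by exact_mod_cast Nat.zero_le _)⟩
      (missingUpperBoundAt_g443205j1_3 hGZ hKo hMN hGZK hmod hWeq hN hr htam D hc K hK hdK hWdeq hrd hqd hvd))

/-- **`BSD(E,3)` (Miller) for the PAIR `E = 447174cg1`, `p = 3`** — O6 wild `3`, U₀-ns ♭ row, `E[3]` irreducible, `r_an = 0`,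
Cremona `#Ш(E)_an = 1` (a `3`-adic unit, DISPLAYED as `hsha`/`hv₀`): from the landed record `missingUpperBoundAt_g447174cg1_3`
(upper half ⟸ MN19 0.3 + GZ + Kolyvagin + GZK + modularity + the unit rank-one twist `d_K = -2159`, all displayed) the lower half is
trivial and GZK closes Miller's `BSD(E,3)`.  CONDITIONAL on the displayed hypotheses; per pair; books nothing by itself.
[cite: Miller2011LMS, §1 and Def. 1.1] [cite: MatarNekovar2019, Thm. 0.3 (p. 456)] [cite: Cremona2006, Table 4 (Cremona label 447174cg1)] -/
theorem bsdp_g447174cg1_3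
    (hGZ : ∀ (N : ℕ) [NeZero N] (W : WeierstrassCurve ℚ) (K : Type) [Field K] [NumberField K],
      gross_zagier N W K)
    (hKo : ∀ (N : ℕ) [NeZero N] (W : WeierstrassCurve ℚ) (K : Type) [Field K] [NumberField K],
      kolyvagin N W K)
    (hMN : ∀ (N : ℕ) [NeZero N] (W : WeierstrassCurve ℚ) (K : Type) [Field K] [NumberField K],
      MatarNekovar2019.thm03_padicValNat_card_sha_le_of_irreducible N W K)
    (hGZK : rank_eq_analyticRank_of_analyticRank_le_one) (hmod : hasEntireLFunction_rat)
    {W : WeierstrassCurve ℚ} [W.IsElliptic] [W.IsGloballyMinimal] (hWeq : W = (⟨1, (-1), 0, (-908322), (-266419308)⟩ : WeierstrassCurve ℚ))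
    (hN : W.conductorNorm ℤ = 447174) (hr : W.analyticRank = 0) (htam : ¬ 3 ∣ W.tamagawaProduct)
    (D : ModularParametrizationData W 447174) (hc : ¬ (3 : ℤ) ∣ D.c)
    (K : Type) [Field K] [NumberField K] (hK : IsImaginaryQuadratic K) (hdK : NumberField.discr K = -2159)
    {Wd : WeierstrassCurve ℚ} [Wd.IsElliptic] [Wd.IsGloballyMinimal] (hWdeq : Wd = (⟨1, (-1), 0, (-4233944954472), 2683451833033019712⟩ : WeierstrassCurve ℚ))
    (hrd : Wd.analyticRank = 1) {qd : ℚ} (hqd : shaAn Wd = (qd : ℂ)) (hvd : padicValRat 3 qd ≤ 0)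
    {q₀ : ℚ} (hsha : shaAn W = (q₀ : ℂ)) (hv₀ : padicValRat 3 q₀ ≤ 0) :
    BSDp W 3 :=
  bsdp_of_missingPPartAt W 3 hGZK (by rw [hr]; exact zero_le_one)
    (missingPPartAt_of_lower_of_upper W 3 ⟨q₀, hsha, le_trans hv₀ (by exact_mod_cast Nat.zero_le _)⟩
      (missingUpperBoundAt_g447174cg1_3 hGZ hKo hMN hGZK hmod hWeq hN hr htam D hc K hK hdK hWdeq hrd hqd hvd))

/-- **`BSD(E,3)` (Miller) for the PAIR `E = 457056bd1`, `p = 3`** — O6 wild `3`, U₀-ns ♭ row, `E[3]` irreducible, `r_an = 0`,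
Cremona `#Ш(E)_an = 1` (a `3`-adic unit, DISPLAYED as `hsha`/`hv₀`): from the landed record `missingUpperBoundAt_g457056bd1_3`
(upper half ⟸ MN19 0.3 + GZ + Kolyvagin + GZK + modularity + the unit rank-one twist `d_K = -551`, all displayed) the lower half is
trivial and GZK closes Miller's `BSD(E,3)`.  CONDITIONAL on the displayed hypotheses; per pair; books nothing by itself.
[cite: Miller2011LMS, §1 and Def. 1.1] [cite: MatarNekovar2019, Thm. 0.3 (p. 456)] [cite: Cremona2006, Table 4 (Cremona label 457056bd1)] -/
theorem bsdp_g457056bd1_3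
    (hGZ : ∀ (N : ℕ) [NeZero N] (W : WeierstrassCurve ℚ) (K : Type) [Field K] [NumberField K],
      gross_zagier N W K)
    (hKo : ∀ (N : ℕ) [NeZero N] (W : WeierstrassCurve ℚ) (K : Type) [Field K] [NumberField K],
      kolyvagin N W K)
    (hMN : ∀ (N : ℕ) [NeZero N] (W : WeierstrassCurve ℚ) (K : Type) [Field K] [NumberField K],
      MatarNekovar2019.thm03_padicValNat_card_sha_le_of_irreducible N W K)
    (hGZK : rank_eq_analyticRank_of_analyticRank_le_one) (hmod : hasEntireLFunction_rat)
    {W : WeierstrassCurve ℚ} [W.IsElliptic] [W.IsGloballyMinimal] (hWeq : W = (⟨0, 0, 0, (-112677), 14308392⟩ : WeierstrassCurve ℚ))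
    (hN : W.conductorNorm ℤ = 457056) (hr : W.analyticRank = 0) (htam : ¬ 3 ∣ W.tamagawaProduct)
    (D : ModularParametrizationData W 457056) (hc : ¬ (3 : ℤ) ∣ D.c)
    (K : Type) [Field K] [NumberField K] (hK : IsImaginaryQuadratic K) (hdK : NumberField.discr K = -551)
    {Wd : WeierstrassCurve ℚ} [Wd.IsElliptic] [Wd.IsGloballyMinimal] (hWdeq : Wd = (⟨0, 0, 0, (-34208849877), (-2393567207895192)⟩ : WeierstrassCurve ℚ))
    (hrd : Wd.analyticRank = 1) {qd : ℚ} (hqd : shaAn Wd = (qd : ℂ)) (hvd : padicValRat 3 qd ≤ 0)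
    {q₀ : ℚ} (hsha : shaAn W = (q₀ : ℂ)) (hv₀ : padicValRat 3 q₀ ≤ 0) :
    BSDp W 3 :=
  bsdp_of_missingPPartAt W 3 hGZK (by rw [hr]; exact zero_le_one)
    (missingPPartAt_of_lower_of_upper W 3 ⟨q₀, hsha, le_trans hv₀ (by exact_mod_cast Nat.zero_le _)⟩
      (missingUpperBoundAt_g457056bd1_3 hGZ hKo hMN hGZK hmod hWeq hN hr htam D hc K hK hdK hWdeq hrd hqd hvd))

/-- **`BSD(E,3)` (Miller) for the PAIR `E = 496800cq1`, `p = 3`** — O6 wild `3`, U₀-ns ♭ row, `E[3]` irreducible, `r_an = 0`,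
Cremona `#Ш(E)_an = 1` (a `3`-adic unit, DISPLAYED as `hsha`/`hv₀`): from the landed record `missingUpperBoundAt_g496800cq1_3`
(upper half ⟸ MN19 0.3 + GZ + Kolyvagin + GZK + modularity + the unit rank-one twist `d_K = -1079`, all displayed) the lower half is
trivial and GZK closes Miller's `BSD(E,3)`.  CONDITIONAL on the displayed hypotheses; per pair; books nothing by itself.
[cite: Miller2011LMS, §1 and Def. 1.1] [cite: MatarNekovar2019, Thm. 0.3 (p. 456)] [cite: Cremona2006, Table 4 (Cremona label 496800cq1)] -/
theorem bsdp_g496800cq1_3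
    (hGZ : ∀ (N : ℕ) [NeZero N] (W : WeierstrassCurve ℚ) (K : Type) [Field K] [NumberField K],
      gross_zagier N W K)
    (hKo : ∀ (N : ℕ) [NeZero N] (W : WeierstrassCurve ℚ) (K : Type) [Field K] [NumberField K],
      kolyvagin N W K)
    (hMN : ∀ (N : ℕ) [NeZero N] (W : WeierstrassCurve ℚ) (K : Type) [Field K] [NumberField K],
      MatarNekovar2019.thm03_padicValNat_card_sha_le_of_irreducible N W K)
    (hGZK : rank_eq_analyticRank_of_analyticRank_le_one) (hmod : hasEntireLFunction_rat)
    {W : WeierstrassCurve ℚ} [W.IsElliptic] [W.IsGloballyMinimal] (hWeq : W = (⟨0, 0, 0, (-5325), 147000⟩ : WeierstrassCurve ℚ))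
    (hN : W.conductorNorm ℤ = 496800) (hr : W.analyticRank = 0) (htam : ¬ 3 ∣ W.tamagawaProduct)
    (D : ModularParametrizationData W 496800) (hc : ¬ (3 : ℤ) ∣ D.c)
    (K : Type) [Field K] [NumberField K] (hK : IsImaginaryQuadratic K) (hdK : NumberField.discr K = -1079)
    {Wd : WeierstrassCurve ℚ} [Wd.IsElliptic] [Wd.IsGloballyMinimal] (hWdeq : Wd = (⟨0, 0, 0, (-6199583325), (-184663757733000)⟩ : WeierstrassCurve ℚ))
    (hrd : Wd.analyticRank = 1) {qd : ℚ} (hqd : shaAn Wd = (qd : ℂ)) (hvd : padicValRat 3 qd ≤ 0)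
    {q₀ : ℚ} (hsha : shaAn W = (q₀ : ℂ)) (hv₀ : padicValRat 3 q₀ ≤ 0) :
    BSDp W 3 :=
  bsdp_of_missingPPartAt W 3 hGZK (by rw [hr]; exact zero_le_one)
    (missingPPartAt_of_lower_of_upper W 3 ⟨q₀, hsha, le_trans hv₀ (by exact_mod_cast Nat.zero_le _)⟩
      (missingUpperBoundAt_g496800cq1_3 hGZ hKo hMN hGZK hmod hWeq hN hr htam D hc K hK hdK hWdeq hrd hqd hvd))

/-- **`BSD(E,3)` (Miller) for the PAIR `E = 499392kg1`, `p = 3`** — O6 wild `3`, U₀-ns ♭ row, `E[3]` irreducible, `r_an = 0`,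
Cremona `#Ш(E)_an = 1` (a `3`-adic unit, DISPLAYED as `hsha`/`hv₀`): from the landed record `missingUpperBoundAt_g499392kg1_3`
(upper half ⟸ MN19 0.3 + GZ + Kolyvagin + GZK + modularity + the unit rank-one twist `d_K = -1271`, all displayed) the lower half is
trivial and GZK closes Miller's `BSD(E,3)`.  CONDITIONAL on the displayed hypotheses; per pair; books nothing by itself.
[cite: Miller2011LMS, §1 and Def. 1.1] [cite: MatarNekovar2019, Thm. 0.3 (p. 456)] [cite: Cremona2006, Table 4 (Cremona label 499392kg1)] -/
theorem bsdp_g499392kg1_3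
    (hGZ : ∀ (N : ℕ) [NeZero N] (W : WeierstrassCurve ℚ) (K : Type) [Field K] [NumberField K],
      gross_zagier N W K)
    (hKo : ∀ (N : ℕ) [NeZero N] (W : WeierstrassCurve ℚ) (K : Type) [Field K] [NumberField K],
      kolyvagin N W K)
    (hMN : ∀ (N : ℕ) [NeZero N] (W : WeierstrassCurve ℚ) (K : Type) [Field K] [NumberField K],
      MatarNekovar2019.thm03_padicValNat_card_sha_le_of_irreducible N W K)
    (hGZK : rank_eq_analyticRank_of_analyticRank_le_one) (hmod : hasEntireLFunction_rat)
    {W : WeierstrassCurve ℚ} [W.IsElliptic] [W.IsGloballyMinimal] (hWeq : W = (⟨0, 0, 0, (-1734), 29478⟩ : WeierstrassCurve ℚ))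
    (hN : W.conductorNorm ℤ = 499392) (hr : W.analyticRank = 0) (htam : ¬ 3 ∣ W.tamagawaProduct)
    (D : ModularParametrizationData W 499392) (hc : ¬ (3 : ℤ) ∣ D.c)
    (K : Type) [Field K] [NumberField K] (hK : IsImaginaryQuadratic K) (hdK : NumberField.discr K = -1271)
    {Wd : WeierstrassCurve ℚ} [Wd.IsElliptic] [Wd.IsGloballyMinimal] (hWdeq : Wd = (⟨0, 0, 0, (-2801174694), (-60524981613258)⟩ : WeierstrassCurve ℚ))
    (hrd : Wd.analyticRank = 1) {qd : ℚ} (hqd : shaAn Wd = (qd : ℂ)) (hvd : padicValRat 3 qd ≤ 0)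
    {q₀ : ℚ} (hsha : shaAn W = (q₀ : ℂ)) (hv₀ : padicValRat 3 q₀ ≤ 0) :
    BSDp W 3 :=
  bsdp_of_missingPPartAt W 3 hGZK (by rw [hr]; exact zero_le_one)
    (missingPPartAt_of_lower_of_upper W 3 ⟨q₀, hsha, le_trans hv₀ (by exact_mod_cast Nat.zero_le _)⟩
      (missingUpperBoundAt_g499392kg1_3 hGZ hKo hMN hGZK hmod hWeq hN hr htam D hc K hK hdK hWdeq hrd hqd hvd))

end Summit.BirchSwinnertonDyer.BirchSwinnertonDyer.Theorems.WildUpperUnitTwistRecords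

end
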